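import Summits.RiemannHypothesis.RiemannHypothesis.Theorems.SpectralTraceWindowTraceArchStubStructureAssemblyAux
import HarnessLib

/-!
# RiemannHypothesis / SpectralTrace — crux `WindowTraceArch`, line `defect-compactness-design`:
# the structure assembly — every witness is a bounded displacement of the França–LeClair lattice

Route `RiemannHypothesis/SpectralTrace`, crux item stmt-RiemannHypothesis-11195 (`WindowTraceArch`),
line `defect-compactness-design`, wave 2 ("structure of witnesses"), stub `stub_structureAssembly`
(helper file 2 of 2, `--supports`; held by the line lead; part 1 =
`…StubStructureAssemblyAux.lean`: reflection of witnesses, infinitude of both sides, the sorted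
positive lattice `p`).

**Statement.** Given (as hypotheses, proved in the sibling files of this wave) the two-sided
COUNTING LAW of witnesses (`stub_countingLaw`: `#{i : γ i ∈ [0,T]} = θ(T)/π + O(log(1+T))`), the
SORTED ENUMERATION of locally finite families (`stub_sortedEnumeration`) and the passage FROM
COUNTING TO DISPLACEMENT (`stub_displacementBound`): if `γ : ι → ℝ` is a witness of the crux (it
reproduces the Weil functional on every Weil test supported in `[-log 2, log 2]`), then for every
injective enumeration `x` of the symmetric França–LeClair lattice
`FL = {t : 7 ≤ |t| ∧ cos θ(t) = 0}` there are `D` and `δ : ℕ → ℝ` with `|δ n| ≤ D` such that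
`n ↦ x n + δ n` is a RE-INDEXING of `γ` — hence again a witness.

**Proof.** (1) The reflected family `-γ` is also a witness (`weilMellin_comp_neg`,
`weilFunctional_comp_neg`: Weil's distribution and the window are even). (2) Local finiteness of
witnesses (`finite_abs_le_of_windowTraceArch_witness`) and the counting law (with `θ(T) ≥ T/2 − 2`,
`log ≤ 2√·`) make both index sets `{γ ≥ 0}` and `{γ < 0}` infinite; sort them
(`stub_sortedEnumeration`, the negative one through the subtype `{i // γ i < 0}`). (3) The positive
lattice points in increasing order are `p n`, `θ(p n) = (n − ½)π`, `p n ≥ 7` (IVT from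
`θ(7) ∈ (−3π/2, −π/2)`; `FL = {p n} ⊔ {−p n}` since `cos θ t = 0 ↔ θ t ∈ π/2 + πℤ` and `θ` is odd and
strictly increasing on `[7,∞)`). (4) `stub_displacementBound` gives `|γ(ep n) − p n| ≤ Dp` and
`|γ(em n) + p n| ≤ Dm` (the counting law of `−γ` on `{γ < 0}` loses only the finitely many zeros).
(5) Transport along the bijection `ℕ ≃ ι` obtained by composing `x : ℕ ≃ FL`, `FL ≃ ℕ ⊕ ℕ` and
`ep ⊕ em : ℕ ⊕ ℕ ≃ ι` (`Equiv.hasSum_iff`).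

Imports only landed tree modules; no named fact is used; no definitions.
-/

set_option linter.dupNamespace false

noncomputable section

open Complex Filter Set MeasureTheory
open scoped Real Topology

namespace Summit.RiemannHypothesis.RiemannHypothesis.Theorems.SpectralTraceWindowTraceArch

open Literature.NumberTheory.LFunctions
open Literature.Barriers.RiemannHypothesis
open Summit.RiemannHypothesis.RiemannHypothesis.Theorems.WindowTraceArch.Negative

/-! ## (4)–(5) The assembly -/

/-- **Every witness is a bounded displacement of the França–LeClair lattice** — the registered stub
`stub_structureAssembly` of the line `defect-compactness-design` (wave 2), from the counting law,
the sorted enumeration and the counting-to-displacement lemma taken as hypotheses. -/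
theorem stub_structureAssembly :
    (∀ (ι : Type) (γ : ι → ℝ),
      (∀ g : ℝ → ℂ, Literature.NumberTheory.LFunctions.IsWeilTest g →
        tsupport g ⊆ Set.Icc (-Real.log 2) (Real.log 2) →
        HasSum (fun i => Literature.NumberTheory.LFunctions.weilMellin g (1 / 2 + (γ i : ℂ) * Complex.I))
          (Literature.NumberTheory.LFunctions.weilFunctional g)) →
      ∃ C : ℝ, ∀ T : ℝ, 0 ≤ T →
        {i : ι | γ i ∈ Set.Icc 0 T}.Finite ∧
        |(({i : ι | γ i ∈ Set.Icc 0 T}.ncard : ℕ) : ℝ) -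
            Literature.NumberTheory.LFunctions.riemannSiegelTheta T / Real.pi| ≤ C * (1 + Real.log (1 + T))) →
    (∀ (ι : Type) (γ : ι → ℝ), (∀ R : ℝ, {i : ι | |γ i| ≤ R}.Finite) → {i : ι | 0 ≤ γ i}.Infinite →
      ∃ e : ℕ → ι, Function.Injective e ∧ Set.range e = {i : ι | 0 ≤ γ i} ∧ Monotone (fun n => γ (e n))) →
    (∀ (a p : ℕ → ℝ) (C : ℝ), Monotone a → (∀ n, 0 ≤ a n) → StrictMono p → (∀ n, 7 ≤ p n) →
      (∀ n : ℕ, Literature.NumberTheory.LFunctions.riemannSiegelTheta (p n) = ((n : ℝ) - 1 / 2) * Real.pi) →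
      (∀ T : ℝ, 0 ≤ T → {n : ℕ | a n ≤ T}.Finite ∧
        |(({n : ℕ | a n ≤ T}.ncard : ℕ) : ℝ) -
            Literature.NumberTheory.LFunctions.riemannSiegelTheta T / Real.pi| ≤ C * (1 + Real.log (1 + T))) →
      ∃ D : ℝ, ∀ n, |a n - p n| ≤ D) →
    ∀ (ι : Type) (γ : ι → ℝ),
      (∀ g : ℝ → ℂ, Literature.NumberTheory.LFunctions.IsWeilTest g →
        tsupport g ⊆ Set.Icc (-Real.log 2) (Real.log 2) →
        HasSum (fun i => Literature.NumberTheory.LFunctions.weilMellin g (1 / 2 + (γ i : ℂ) * Complex.I))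
          (Literature.NumberTheory.LFunctions.weilFunctional g)) →
      ∀ x : ℕ → ℝ, Function.Injective x →
        Set.range x = {t : ℝ | 7 ≤ |t| ∧ Real.cos (Literature.NumberTheory.LFunctions.riemannSiegelTheta t) = 0} →
        ∃ (D : ℝ) (δ : ℕ → ℝ), (∀ n, |δ n| ≤ D) ∧
          ∀ g : ℝ → ℂ, Literature.NumberTheory.LFunctions.IsWeilTest g →
            tsupport g ⊆ Set.Icc (-Real.log 2) (Real.log 2) →
            HasSum (fun n => Literature.NumberTheory.LFunctions.weilMellin g (1 / 2 + ((x n + δ n : ℝ) : ℂ) * Complex.I))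
              (Literature.NumberTheory.LFunctions.weilFunctional g) := by
  intro hCL hSE hDB ι γ hγ x hxinj hxrange
  classical
  -- local finiteness of `γ` and of `-γ`
  have hlf : ∀ R : ℝ, {i : ι | |γ i| ≤ R}.Finite := finite_abs_le_of_windowTraceArch_witness hγ
  have hγ' := stub_structureAssembly_reflect hγ
  have hlf' : ∀ R : ℝ, {i : ι | |(-γ i)| ≤ R}.Finite := fun R => by simpa using hlf R
  -- counting laws
  obtain ⟨Cp, hCp⟩ := hCL ι γ hγ
  obtain ⟨Cm, hCm⟩ := hCL ι (fun i => -γ i) hγ'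
  -- (2) both sides infinite
  have hinfp : {i : ι | 0 ≤ γ i}.Infinite := stub_structureAssembly_infinite hCp
  have hinfm' : {i : ι | 0 ≤ -γ i}.Infinite := stub_structureAssembly_infinite hCm
  have hZfin : {i : ι | γ i = 0}.Finite := (hlf 0).subset fun i hi => by
    simp only [mem_setOf_eq] at hi ⊢; rw [hi, abs_zero]
  have hinfm : {i : ι | γ i < 0}.Infinite := by
    have hsplit : {i : ι | 0 ≤ -γ i} ⊆ {i : ι | γ i < 0} ∪ {i : ι | γ i = 0} := by
      intro i hi
      simp only [mem_setOf_eq, mem_union] at hi ⊢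
      rcases lt_or_eq_of_le (neg_nonneg.1 hi) with h | h
      · exact Or.inl h
      · exact Or.inr h
    intro hfin
    exact hinfm' ((hfin.union hZfin).subset hsplit)
  -- sorted enumeration of the non-negative side
  obtain ⟨ep, hepinj, heprange, hepmono⟩ := hSE ι γ hlf hinfp
  -- sorted enumeration of the negative side through the subtype `{i // γ i < 0}`
  let κ : Type := {i : ι // γ i < 0}
  have hκlf : ∀ R : ℝ, {j : κ | |(-γ j.1)| ≤ R}.Finite := by
    intro R
    have h1 : {j : κ | |(-γ j.1)| ≤ R} = Subtype.val ⁻¹' {i : ι | |γ i| ≤ R} := by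
      ext j; simp only [mem_setOf_eq, mem_preimage, abs_neg]
    rw [h1]
    exact (hlf R).preimage Subtype.val_injective.injOn
  have hκinf : {j : κ | 0 ≤ -γ j.1}.Infinite := by
    have h1 : {j : κ | 0 ≤ -γ j.1} = Set.univ := by
      ext j; simpa using j.2.le
    rw [h1]
    have : Infinite κ := (Set.infinite_coe_iff.2 hinfm)
    exact Set.infinite_univ
  obtain ⟨em, heminj, hemrange, hemmono⟩ := hSE κ (fun j => -γ j.1) hκlf hκinf
  -- (3) the lattice
  obtain ⟨p, hpmono, hp7, hpθ, hFL, hpm⟩ := stub_structureAssembly_lattice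
  -- (4) displacement bounds on each side
  -- positive side: `a₊ n = γ (ep n)`
  have hap : ∃ Dp : ℝ, ∀ n, |γ (ep n) - p n| ≤ Dp := by
    refine hDB (fun n => γ (ep n)) p Cp hepmono (fun n => ?_) hpmono hp7 hpθ (fun T hT => ?_)
    · have : ep n ∈ Set.range ep := ⟨n, rfl⟩
      rw [heprange] at this; exact this
    · -- `{n | γ (ep n) ≤ T}` is in bijection with `{i | γ i ∈ Icc 0 T}` via `ep`
      have himage : ep '' {n : ℕ | γ (ep n) ≤ T} = {i : ι | γ i ∈ Icc 0 T} := by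
        ext i
        constructor
        · rintro ⟨n, hn, rfl⟩
          have h0 : 0 ≤ γ (ep n) := by
            have : ep n ∈ Set.range ep := ⟨n, rfl⟩
            rw [heprange] at this; exact this
          exact ⟨h0, hn⟩
        · rintro ⟨h0, hT'⟩
          have : i ∈ Set.range ep := by rw [heprange]; exact h0
          obtain ⟨n, rfl⟩ := this
          exact ⟨n, hT', rfl⟩
      obtain ⟨hfinT, hcountT⟩ := hCp T hT
      have hfinN : {n : ℕ | γ (ep n) ≤ T}.Finite := by
        have : (ep '' {n : ℕ | γ (ep n) ≤ T}).Finite := by rw [himage]; exact hfinT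
        exact (Set.finite_image_iff hepinj.injOn).1 this
      refine ⟨hfinN, ?_⟩
      have hnc : {n : ℕ | γ (ep n) ≤ T}.ncard = {i : ι | γ i ∈ Icc 0 T}.ncard := by
        rw [← himage, Set.ncard_image_of_injective _ hepinj]
      rw [hnc]; exact hcountT
  -- negative side: `a₋ n = -γ (em n)`; the counting set differs from that of `-γ` by the zeros
  have ham : ∃ Dm : ℝ, ∀ n, |(-γ (em n).1) - p n| ≤ Dm := by
    set z : ℕ := hZfin.toFinset.card with hz
    have hCm0 : 0 ≤ Cm := by
      have h0 := (hCm 0 le_rfl).2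
      have : (0 : ℝ) ≤ Cm * (1 + Real.log (1 + 0)) := le_trans (abs_nonneg _) h0
      simpa using this
    refine hDB (fun n => -γ (em n).1) p (Cm + z) hemmono (fun n => by
      show (0 : ℝ) ≤ -γ (em n).1
      linarith [(em n).2]) hpmono hp7 hpθ (fun T hT => ?_)
    -- `A := {n | -γ (em n) ≤ T}` ↔ `B := {i | γ i < 0 ∧ -T ≤ γ i}`; and
    -- `S := {i | -γ i ∈ Icc 0 T} = B ∪ (zeros)` disjointly
    have himage : (fun n => (em n).1) '' {n : ℕ | -γ (em n).1 ≤ T} = {i : ι | γ i < 0 ∧ -T ≤ γ i} := by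
      ext i
      constructor
      · rintro ⟨n, hn, rfl⟩
        exact ⟨(em n).2, by simp only [mem_setOf_eq] at hn; linarith⟩
      · rintro ⟨hneg, hTi⟩
        have : (⟨i, hneg⟩ : κ) ∈ Set.range em := by
          rw [hemrange]; show (0 : ℝ) ≤ -γ i; linarith
        obtain ⟨n, hn⟩ := this
        have hval : (em n).1 = i := by rw [hn]
        refine ⟨n, ?_, hval⟩
        show -γ (em n).1 ≤ T
        rw [hval]; linarith
    have hinj' : Function.Injective (fun n => (em n).1) :=
      Subtype.val_injective.comp heminj
    obtain ⟨hfinT, hcountT⟩ := hCm T hT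
    have hBsub : {i : ι | γ i < 0 ∧ -T ≤ γ i} ⊆ {i : ι | -γ i ∈ Icc 0 T} := by
      intro i ⟨h1, h2⟩; simp only [mem_setOf_eq, mem_Icc]; constructor <;> linarith
    have hBfin : {i : ι | γ i < 0 ∧ -T ≤ γ i}.Finite := hfinT.subset hBsub
    have hfinN : {n : ℕ | -γ (em n).1 ≤ T}.Finite := by
      have : ((fun n => (em n).1) '' {n : ℕ | -γ (em n).1 ≤ T}).Finite := by rw [himage]; exact hBfin
      exact (Set.finite_image_iff hinj'.injOn).1 this
    refine ⟨hfinN, ?_⟩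
    have hnc : {n : ℕ | -γ (em n).1 ≤ T}.ncard = {i : ι | γ i < 0 ∧ -T ≤ γ i}.ncard := by
      rw [← himage, Set.ncard_image_of_injective _ hinj']
    -- `S ⊆ B ∪ Z` and `B ⊆ S`, so `ncard B ≤ ncard S ≤ ncard B + z`
    have hSsub : {i : ι | -γ i ∈ Icc 0 T} ⊆ {i : ι | γ i < 0 ∧ -T ≤ γ i} ∪ {i : ι | γ i = 0} := by
      intro i hi
      simp only [mem_setOf_eq, mem_Icc, mem_union] at hi ⊢
      rcases lt_or_eq_of_le (neg_nonneg.1 hi.1) with h | h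
      · exact Or.inl ⟨h, by linarith⟩
      · exact Or.inr h
    have h1 : ({i : ι | γ i < 0 ∧ -T ≤ γ i}.ncard : ℝ) ≤ {i : ι | -γ i ∈ Icc 0 T}.ncard := by
      exact_mod_cast Set.ncard_le_ncard hBsub hfinT
    have h2 : ({i : ι | -γ i ∈ Icc 0 T}.ncard : ℝ) ≤ {i : ι | γ i < 0 ∧ -T ≤ γ i}.ncard + z := by
      have h3 := Set.ncard_le_ncard hSsub (hBfin.union hZfin)
      have h4 := Set.ncard_union_le {i : ι | γ i < 0 ∧ -T ≤ γ i} {i : ι | γ i = 0}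
      rw [Set.ncard_eq_toFinset_card _ hZfin] at h4
      exact_mod_cast h3.trans h4
    rw [hnc]
    have hlog0 : 0 ≤ Real.log (1 + T) := Real.log_nonneg (by linarith)
    have hz0 : (0 : ℝ) ≤ z := Nat.cast_nonneg _
    rw [abs_le] at hcountT ⊢
    constructor
    · nlinarith [hcountT.1, hcountT.2]
    · nlinarith [hcountT.1, hcountT.2]
  obtain ⟨Dp, hDp⟩ := hap
  obtain ⟨Dm, hDm⟩ := ham
  -- (5) the bijection `ℕ ≃ ι`
  -- `φ : ℕ ⊕ ℕ → ι`, `inl k ↦ ep k`, `inr k ↦ em k`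
  let φ : ℕ ⊕ ℕ → ι := Sum.elim ep (fun k => (em k).1)
  have hφbij : Function.Bijective φ := by
    constructor
    · rintro (k | k) (l | l) h
      · simp only [φ, Sum.elim_inl] at h; rw [hepinj h]
      · exfalso
        simp only [φ, Sum.elim_inl, Sum.elim_inr] at h
        have h0 : 0 ≤ γ (ep k) := by
          have : ep k ∈ Set.range ep := ⟨k, rfl⟩
          rw [heprange] at this; exact this
        have h1 := (em l).2
        rw [h] at h0; linarith
      · exfalso
        simp only [φ, Sum.elim_inl, Sum.elim_inr] at h
        have h0 : 0 ≤ γ (ep l) := by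
          have : ep l ∈ Set.range ep := ⟨l, rfl⟩
          rw [heprange] at this; exact this
        have h1 := (em k).2
        rw [← h] at h0; linarith
      · simp only [φ, Sum.elim_inr] at h
        rw [heminj (Subtype.val_injective h)]
    · intro i
      rcases lt_or_ge (γ i) 0 with hneg | hnn
      · have : (⟨i, hneg⟩ : κ) ∈ Set.range em := by
          rw [hemrange]; show (0 : ℝ) ≤ -γ i; linarith
        obtain ⟨k, hk⟩ := this
        exact ⟨Sum.inr k, by simp [φ, hk]⟩
      · have : i ∈ Set.range ep := by rw [heprange]; exact hnn
        obtain ⟨k, hk⟩ := this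
        exact ⟨Sum.inl k, by simp [φ, hk]⟩
  -- `ψ : ℕ ⊕ ℕ → ℝ`, `inl k ↦ p k`, `inr k ↦ -p k`, a bijection onto `FL = range x`
  let ψ : ℕ ⊕ ℕ → ℝ := Sum.elim p (fun k => -p k)
  have hψinj : Function.Injective ψ := by
    rintro (k | k) (l | l) h
    · simp only [ψ, Sum.elim_inl] at h; rw [hpmono.injective h]
    · exfalso; simp only [ψ, Sum.elim_inl, Sum.elim_inr] at h; exact hpm k l h
    · exfalso; simp only [ψ, Sum.elim_inl, Sum.elim_inr] at h; exact hpm l k h.symm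
    · simp only [ψ, Sum.elim_inr, neg_inj] at h; rw [hpmono.injective h]
  have hψrange : Set.range ψ = Set.range x := by
    rw [hxrange]
    ext t
    simp only [Set.mem_range, mem_setOf_eq]
    rw [hFL t]
    constructor
    · rintro ⟨(k | k), rfl⟩
      · exact ⟨k, Or.inl rfl⟩
      · exact ⟨k, Or.inr rfl⟩
    · rintro ⟨n, h | h⟩
      · exact ⟨Sum.inl n, h.symm⟩
      · exact ⟨Sum.inr n, h.symm⟩
  -- for each `n`, the unique `m : ℕ ⊕ ℕ` with `ψ m = x n`
  have hxm : ∀ n : ℕ, ∃ m : ℕ ⊕ ℕ, ψ m = x n := fun n => by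
    have : x n ∈ Set.range ψ := by rw [hψrange]; exact ⟨n, rfl⟩
    exact this
  choose m hm using hxm
  have hminj : Function.Injective m := fun n n' h => hxinj (by rw [← hm n, ← hm n', h])
  have hmsurj : Function.Surjective m := fun s => by
    have : ψ s ∈ Set.range x := by rw [← hψrange]; exact ⟨s, rfl⟩
    obtain ⟨n, hn⟩ := this
    exact ⟨n, hψinj ((hm n).trans hn)⟩
  -- the relabelling `σ = φ ∘ m : ℕ → ι` is a bijection
  let σ : ℕ → ι := fun n => φ (m n)
  have hσbij : Function.Bijective σ := hφbij.comp ⟨hminj, hmsurj⟩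
  let E : ℕ ≃ ι := Equiv.ofBijective σ hσbij
  -- the displacement
  refine ⟨max Dp Dm, fun n => γ (σ n) - x n, fun n => ?_, fun g hg hgs => ?_⟩
  · -- bound: case on `m n`
    show |γ (σ n) - x n| ≤ max Dp Dm
    have hx : x n = ψ (m n) := (hm n).symm
    rcases hmn : m n with k | k
    · have hσ : σ n = ep k := by simp [σ, φ, hmn]
      rw [hσ, hx, hmn]
      simp only [ψ, Sum.elim_inl]
      exact (hDp k).trans (le_max_left _ _)
    · have hσ : σ n = (em k).1 := by simp [σ, φ, hmn]
      rw [hσ, hx, hmn]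
      simp only [ψ, Sum.elim_inr]
      have := hDm k
      rw [show γ (em k).1 - -p k = -((-γ (em k).1) - p k) by ring, abs_neg]
      exact this.trans (le_max_right _ _)
  · -- transport the `HasSum` along `E`
    have hsum := hγ g hg hgs
    have := (E.hasSum_iff (f := fun i => weilMellin g (1 / 2 + (γ i : ℂ) * I))).2 hsum
    refine this.congr_fun fun n => ?_
    simp only [Function.comp_apply, E, Equiv.ofBijective_apply]
    congr 2
    push_cast
    ring

end Summit.RiemannHypothesis.RiemannHypothesis.Theorems.SpectralTraceWindowTraceArch

end
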